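import Literature.Probability.RandomGraphs.LowDegree
import Literature.Probability.RandomGraphs.PlantedCliqueLowDegree
import Mathlib.Analysis.SpecialFunctions.Pow.Real
import HarnessLib

/-!
# The `p`-biased low-degree likelihood ratio (product Bernoulli nulls)

Definition request `defn-biasedLowDegreeLRSq` (route PneNP/RamseyThreshold, crux
`QuietNonArrowingPlanting`, layer-2 split "low-degree quietness"; equally route PneNP/PlantedClique
at `p ≠ 1/2`). The tree's `lowDegreeLRSq` (`LowDegree.lean`) is the squared `D`-low-degree
likelihood ratio against the UNIFORM null on `{0,1}^ι`; here the null is the product law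
`ν_p = Bernoulli(p)^{⊗ι}` (for `ι` = pairs of `Fin n`: `G(n,p)`), as in Hopkins' general framework:
`ν` induces `⟨f,g⟩_ν = E_ν[f g]`, `LR^{≤D}` is the `⟨·,·⟩_ν`-orthogonal projection of
`LR = dμ/dν` onto the functions of coordinate degree `≤ D`, and for an orthonormal basis
`f₀ = 1, f₁, …, f_m` of that space `‖LR^{≤D}‖² = Σᵢ (E_μ fᵢ)²` [Hopkins 2018, §2.3, Thm. 2.3.1 and
eq. (2.3.1)]; "for product distributions, such functions `fᵢ` are simply Fourier bases". For the
`p`-biased cube that basis is `χ^p_S(x) = ∏_{i∈S} φ_p(xᵢ)`, `φ_p(b) = (𝟙[b] - p)/√(p(1-p))`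
[O'Donnell 2014, §8.4, Defs. 8.39–8.40; KWB 2019, Def. 1.14]. Everything is finite, so we DEFINE

* `biasedLowDegreeLRSq p μ D := Σ_{|S| ≤ D} (E_μ[χ^p_S])²` (`biasedCharMean p μ S = E_μ[χ^p_S]`),
  `biasedLowDegreeLR := √·`, and `biasedLRNormSq p μ := Σ_x μ(x)²/ν_p(x) = E_{ν_p}[LR²]`;
* the null itself, `bernoulliPi ι q hq : PMF (ι → Bool)` — the verbatim generalisation of the
  tree's `PlantedClique.bernoulliVec n q hq` (the case `ι = Fin n`; `bernoulliPi_fin`, by `rfl`)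
  to an arbitrary finite index type (needed for marginals on `S → Bool` and for `EdgeVec n`);
* `IsDWiseIndependentWrt ν D μ` — Holmgren–Wein's Def. 1 in full generality ("`μ` is `D`-wise
  independent with respect to `ν` if `μ|_S = ν|_S` for all `|S| ≤ D`"), of which the barrier file's
  `Literature.Barriers.PneNP.IsDWiseIndependent D μ` is the case `ν` uniform;

and PROVE what the request asks for: `biasedLowDegreeLRSq_half` (at `p = 1/2` it IS the tree's
`lowDegreeLRSq`: `φ_{1/2} = -sgn`, so `χ^{1/2}_S = (-1)^{|S|} χ_S` and the squares agree) and
`IsDWiseIndependentWrt.biasedLowDegreeLRSq_eq_one` (`D`-wise independence w.r.t. `ν_p` ⇒ value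
`1`, Hopkins' remark after Def. 2.2.3; generalises
`Literature.Barriers.PneNP.IsDWiseIndependent.lowDegreeLRSq_eq_one`), through: `E[φ_p] = 0`
(`sum_bernWeight_mul_biasChar`), "a character mean sees only the marginal on its support"
(`biasedCharMean_eq_sum_map`), "the null has no nonconstant coefficients"
(`biasedCharMean_bernoulliPi`); plus `D = 0`, monotonicity, `≥ 1`, and the junk value. The basis
facts that JUSTIFY the definition — orthonormality of `(χ^p_S)` in `L²(ν_p)`, Parseval
`biasedLowDegreeLRSq p μ |ι| = biasedLRNormSq p μ`, the marginal formula
`ν_p|_S = Bernoulli(p)^{⊗S}` and the `iff` with the barrier file's `IsDWiseIndependent` at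
`p = 1/2` — are theorems of the companion file `BiasedLowDegreeBasis.lean`.

Conventions and junk values. The bias of the characters is a real `p`; the law `bernoulliPi`
takes `q : ℝ≥0∞` with `q ≤ 1` exactly like `bernoulliVec` (so the route's null
`bernoulliVec (n*n) (min 1 (ENNReal.ofReal p)) _` is literally a `bernoulliPi`), and the theorems
about the null use the bias `q.toReal`. Sign: we follow the request and Hopkins (`2G_{ij} - 1` at
`p = 1/2`, proof of Lemma 2.4.1): `φ_p(true) = (1-p)/√(p(1-p))`; O'Donnell's `φ` (with `true = -1`)
is `-φ_p` — "unique Fourier basis (up to negating `φ`)", immaterial for the squared norm. For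
`p ∉ (0,1)` we have `√(p(1-p)) = 0`, Lean's `x/0 = 0` makes every nonconstant character vanish and
`biasedLowDegreeLRSq p μ D = 1` (`biasedLowDegreeLRSq_eq_one_of_not_bias`; documented junk — the
true LDLR against a degenerate product law is not defined).

NOT here: the abstract `L²(ν)` projection for non-product `ν` (no canonical basis; not requested),
`D`-wise ALMOST independence (Hopkins Def. 2.2.3, an `O(1)` condition on sequences), coordinate-wise
different biases `pᵢ` (O'Donnell Ex. 8.24; not requested).

## References

* S. B. Hopkins, *Statistical inference and the sum of squares method*, PhD thesis, Cornell 2018,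
  §2.2 Def. 2.2.3 (PDF pp. 43–44), §2.3 Thm. 2.3.1, eq. (2.3.1) (PDF pp. 45–47), §2.4 proof of
  Lemma 2.4.1 (PDF p. 48) [Hopkins2018].
* R. O'Donnell, *Analysis of Boolean Functions*, CUP 2014, §8.4, Defs. 8.39–8.40 [ODonnell2014].
* D. Kunisky, A. S. Wein, A. S. Bandeira, arXiv:1907.11636, §1.3, Def. 1.14, Prop. 1.15
  [KuniskyWeinBandeira2019].
* J. Holmgren, A. S. Wein, *Counterexamples to the low-degree conjecture*, ITCS 2021,
  arXiv:2004.08454, Def. 1 (PDF p. 5) [HolmgrenWein2021].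
-/

noncomputable section

namespace Literature.Probability.RandomGraphs.LowDegree

open scoped ENNReal
open Finset PlantedClique

variable {ι : Type*} [Fintype ι] [DecidableEq ι]

/-! ### The null: the product Bernoulli law on `{0,1}^ι` -/

variable (ι) in
/-- **`Bernoulli(q)^{⊗ι}`**, the product law on `ι → Bool` under which each coordinate is `true`
independently with probability `q` (`q ≤ 1`); for `ι` the pairs of `Fin n` this is `G(n,q)`.
The verbatim generalisation of `PlantedClique.bernoulliVec n q hq` (`ι = Fin n`, see
`bernoulliPi_fin`) to an arbitrary finite index type. [O'Donnell 2014, §8.4 (`π_p^{⊗n}`);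
Hopkins 2018, §2.2 ("`ν` a product distribution")] [folklore] -/
def bernoulliPi (q : ℝ≥0∞) (hq : q ≤ 1) : PMF (ι → Bool) :=
  PMF.ofFintype (fun x => ∏ i, bernWeight q (x i)) (by
    rw [← Fintype.prod_sum fun (_ : ι) (b : Bool) => bernWeight q b]
    simp [bernWeight_true_add_false hq])

/-- The mass of a point under `bernoulliPi`. [folklore] -/
@[simp] theorem bernoulliPi_apply (q : ℝ≥0∞) (hq : q ≤ 1) (x : ι → Bool) :
    bernoulliPi ι q hq x = ∏ i, bernWeight q (x i) := rfl

/-- `bernoulliPi (Fin n)` IS the tree's `bernoulliVec n` (definitionally). [folklore] -/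
theorem bernoulliPi_fin (n : ℕ) (q : ℝ≥0∞) (hq : q ≤ 1) :
    bernoulliPi (Fin n) q hq = bernoulliVec n q hq := rfl

/-- The weight of `true` in `ℝ`: `q.toReal`. [folklore] -/
@[simp] theorem toReal_bernWeight_true (q : ℝ≥0∞) : (bernWeight q true).toReal = q.toReal := rfl

/-- The weight of `false` in `ℝ`: `1 - q.toReal` (for `q ≤ 1`). [folklore] -/
theorem toReal_bernWeight_false {q : ℝ≥0∞} (hq : q ≤ 1) :
    (bernWeight q false).toReal = 1 - q.toReal := by
  simp [bernWeight, ENNReal.toReal_sub_of_le hq ENNReal.one_ne_top]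

/-- The real weights sum to `1`. [folklore] -/
theorem sum_toReal_bernWeight {q : ℝ≥0∞} (hq : q ≤ 1) : ∑ b, (bernWeight q b).toReal = 1 := by
  rw [Fintype.sum_bool, toReal_bernWeight_true, toReal_bernWeight_false hq]
  ring

/-! ### `D`-wise independence with respect to a null (Holmgren–Wein, Def. 1) -/

/-- **`μ` is `D`-wise independent with respect to `ν`** (laws on `Ω^ι`): for every `S ⊆ ι` with
`|S| ≤ D` the marginals agree, `μ|_S = ν|_S` (marginal map = `Finset.restrict`). The barrier
file's `Literature.Barriers.PneNP.IsDWiseIndependent D μ` is the case `Ω = Bool`, `ν` uniform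
(`isDWiseIndependentWrt_uniform_iff` in `BiasedLowDegreeBasis.lean`). With respect to a product
`ν` it is the same as "`E_μ f = 0` for every `D`-simple statistic `f`" (Hopkins 2018, remark after
Def. 2.2.3; here: `IsDWiseIndependentWrt.biasedCharMean_eq_zero`).
[cite: HolmgrenWein2021, Def. 1 (PDF p. 5)] -/
def IsDWiseIndependentWrt {Ω : Type*} (ν : PMF (ι → Ω)) (D : ℕ) (μ : PMF (ι → Ω)) : Prop :=
  ∀ S : Finset ι, S.card ≤ D → μ.map S.restrict = ν.map S.restrict

omit [Fintype ι] [DecidableEq ι] in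
/-- Every law is `D`-wise independent with respect to itself. [folklore] -/
theorem IsDWiseIndependentWrt.refl {Ω : Type*} (ν : PMF (ι → Ω)) (D : ℕ) :
    IsDWiseIndependentWrt ν D ν :=
  fun _ _ => rfl

omit [Fintype ι] [DecidableEq ι] in
/-- More independence gives less: `D' ≤ D → D-wise ⇒ D'-wise`. [folklore] -/
theorem IsDWiseIndependentWrt.of_le {Ω : Type*} {ν μ : PMF (ι → Ω)} {D D' : ℕ}
    (h : IsDWiseIndependentWrt ν D μ) (hle : D' ≤ D) : IsDWiseIndependentWrt ν D' μ :=
  fun S hS => h S (hS.trans hle)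

/-! ### The `p`-biased characters -/

/-- The one-bit `p`-biased character `φ_p(b) = (𝟙[b] - p)/√(p(1-p))` (mean `0`, variance `1` under
`Bernoulli(p)`, `0 < p < 1`); O'Donnell's `φ` is `-φ_p`. For `p ∉ (0,1)`: `√(p(1-p)) = 0` and
`φ_p = 0` (junk). [O'Donnell 2014, Def. 8.39; Hopkins 2018, proof of Lemma 2.4.1 (`2G_{ij} - 1` at
`p = 1/2`)] [cite: ODonnell2014, Def. 8.39] -/
def biasChar (p : ℝ) (b : Bool) : ℝ := ((if b then 1 else 0) - p) / Real.sqrt (p * (1 - p))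

/-- `φ_p(true) = (1-p)/√(p(1-p))`. [folklore] -/
@[simp] theorem biasChar_true (p : ℝ) : biasChar p true = (1 - p) / Real.sqrt (p * (1 - p)) := by
  simp [biasChar]

/-- `φ_p(false) = -p/√(p(1-p))`. [folklore] -/
@[simp] theorem biasChar_false (p : ℝ) : biasChar p false = -p / Real.sqrt (p * (1 - p)) := by
  simp [biasChar, neg_div]

/-- **Mean zero**: `E_{Bernoulli(q)}[φ_{q}] = 0` (for every `q ≤ 1`, bias `q.toReal`).
[O'Donnell 2014, §8.4 ("`E[φ(xᵢ)] = 0`")] [folklore] -/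
theorem sum_bernWeight_mul_biasChar {q : ℝ≥0∞} (hq : q ≤ 1) :
    ∑ b, (bernWeight q b).toReal * biasChar q.toReal b = 0 := by
  rw [Fintype.sum_bool, toReal_bernWeight_true, toReal_bernWeight_false hq, biasChar_true,
    biasChar_false]
  ring

/-- The `p`-biased character of `S`: `χ^p_S(x) = ∏_{i ∈ S} φ_p(x i)`.
[O'Donnell 2014, Def. 8.40 (`φ_S`)] [cite: ODonnell2014, Def. 8.40] -/
def biasedWalsh (p : ℝ) (S : Finset ι) (x : ι → Bool) : ℝ := ∏ i ∈ S, biasChar p (x i)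

omit [Fintype ι] [DecidableEq ι] in
/-- `χ^p_∅ = 1`. [folklore] -/
@[simp] theorem biasedWalsh_empty (p : ℝ) (x : ι → Bool) : biasedWalsh p ∅ x = 1 := by
  simp [biasedWalsh]

omit [Fintype ι] [DecidableEq ι] in
/-- A character of `S` factors through the restriction to `S`. [folklore] -/
theorem biasedWalsh_eq_comp_restrict (p : ℝ) (S : Finset ι) (x : ι → Bool) :
    biasedWalsh p S x = ∏ i : S, biasChar p (S.restrict x i) := by
  rw [biasedWalsh, ← prod_coe_sort]
  rfl

/-- The `p`-biased character mean (Fourier coefficient of `dμ/dν_p`):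
`μ̂_p(S) = E_μ[χ^p_S] = Σ_x μ(x) χ^p_S(x)` (`= ⟨LR, χ^p_S⟩_{ν_p}`).
[Hopkins 2018, §2.3 eq. (2.3.1) (`E_μ fᵢ`); O'Donnell 2014, Def. 8.40 (`f̂(S)`)] [folklore] -/
def biasedCharMean (p : ℝ) (μ : PMF (ι → Bool)) (S : Finset ι) : ℝ :=
  ∑ x, (μ x).toReal * biasedWalsh p S x

/-- `E_μ[χ^p_∅] = 1`. [folklore] -/
@[simp] theorem biasedCharMean_empty (p : ℝ) (μ : PMF (ι → Bool)) : biasedCharMean p μ ∅ = 1 := by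
  simp [biasedCharMean, sum_toReal_eq_one]

/-! ### The `p`-biased low-degree likelihood ratio -/

/-- **`‖LR^{≤D}‖²_{L²(ν_p)}`, the squared `D`-low-degree likelihood ratio of `μ` against the
product null `ν_p = Bernoulli(p)^{⊗ι}`**: `Σ_{|S| ≤ D} (E_μ[χ^p_S])²`, the squared `L²(ν_p)`-norm of
the `⟨·,·⟩_{ν_p}`-orthogonal projection of `LR = dμ/dν_p` onto the functions of coordinate degree
`≤ D`, written in the orthonormal basis `(χ^p_S)_{|S| ≤ D}` of that space (the constant `S = ∅`
included, so the value is `≥ 1`; Hopkins' `‖LR^{≤D} - 1‖²` is this minus `1`). At `p = 1/2` it is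
the tree's `lowDegreeLRSq` (`biasedLowDegreeLRSq_half`). Junk value `1` for `p ∉ (0,1)`.
[Hopkins 2018, §2.3, Thm. 2.3.1 and eq. (2.3.1); KWB 2019, Def. 1.14]
[cite: Hopkins2018, §2.3 eq. (2.3.1)] -/
def biasedLowDegreeLRSq (p : ℝ) (μ : PMF (ι → Bool)) (D : ℕ) : ℝ :=
  ∑ S ∈ degLE ι D, biasedCharMean p μ S ^ 2

/-- **`‖LR^{≤D}‖_{L²(ν_p)}`**, the `p`-biased `D`-low-degree likelihood ratio norm.
[Hopkins 2018, Thm. 2.3.1; KWB 2019, Def. 1.14, Prop. 1.15] [cite: Hopkins2018, Thm. 2.3.1] -/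
def biasedLowDegreeLR (p : ℝ) (μ : PMF (ι → Bool)) (D : ℕ) : ℝ :=
  Real.sqrt (biasedLowDegreeLRSq p μ D)

/-- `‖LR‖²_{L²(ν_p)} = E_{ν_p}[LR²] = Σ_x μ(x)²/ν_p(x)` with `ν_p(x) = ∏ᵢ (p if xᵢ else 1-p)`
(`= 1 + χ²(μ‖ν_p)`). [Hopkins 2018, §2.3 (`LR = μ/ν`); KWB 2019, Def. 1.8] [folklore] -/
def biasedLRNormSq (p : ℝ) (μ : PMF (ι → Bool)) : ℝ :=
  ∑ x, (μ x).toReal ^ 2 / ∏ i, (if x i then p else 1 - p)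

/-! ### Elementary identities -/

/-- `biasedLowDegreeLRSq` is nonnegative. [folklore] -/
theorem biasedLowDegreeLRSq_nonneg (p : ℝ) (μ : PMF (ι → Bool)) (D : ℕ) :
    0 ≤ biasedLowDegreeLRSq p μ D :=
  sum_nonneg fun _ _ => sq_nonneg _

/-- `‖LR^{≤0}‖² = 1` (only the constant character). [folklore] -/
@[simp] theorem biasedLowDegreeLRSq_zero (p : ℝ) (μ : PMF (ι → Bool)) :
    biasedLowDegreeLRSq p μ 0 = 1 := by
  simp [biasedLowDegreeLRSq]

/-- `‖LR^{≤0}‖ = 1`. [folklore] -/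
@[simp] theorem biasedLowDegreeLR_zero (p : ℝ) (μ : PMF (ι → Bool)) :
    biasedLowDegreeLR p μ 0 = 1 := by
  simp [biasedLowDegreeLR]

/-- Monotonicity in the degree. [folklore] -/
theorem biasedLowDegreeLRSq_mono (p : ℝ) (μ : PMF (ι → Bool)) :
    Monotone (biasedLowDegreeLRSq p μ) :=
  fun _ _ h => sum_le_sum_of_subset_of_nonneg (degLE_mono h) fun _ _ _ => sq_nonneg _

/-- Hence `1 ≤ ‖LR^{≤D}‖²`. [folklore] -/
theorem one_le_biasedLowDegreeLRSq (p : ℝ) (μ : PMF (ι → Bool)) (D : ℕ) :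
    1 ≤ biasedLowDegreeLRSq p μ D := by
  simpa using biasedLowDegreeLRSq_mono p μ (Nat.zero_le D)

/-- The documented junk value: for `p ∉ (0,1)` every nonconstant character vanishes and
`biasedLowDegreeLRSq p μ D = 1`. [folklore] -/
theorem biasedLowDegreeLRSq_eq_one_of_not_bias {p : ℝ} (hp : p ≤ 0 ∨ 1 ≤ p) (μ : PMF (ι → Bool))
    (D : ℕ) : biasedLowDegreeLRSq p μ D = 1 := by
  have hsqrt : Real.sqrt (p * (1 - p)) = 0 := by
    rw [Real.sqrt_eq_zero']
    rcases hp with hp | hp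
    · exact mul_nonpos_of_nonpos_of_nonneg hp (by linarith)
    · exact mul_nonpos_of_nonneg_of_nonpos (by linarith) (by linarith)
  have hchar : ∀ b, biasChar p b = 0 := fun b => by simp [biasChar, hsqrt]
  unfold biasedLowDegreeLRSq
  rw [← sum_erase_add _ _ (show (∅ : Finset ι) ∈ degLE ι D by simp [degLE])]
  rw [sum_eq_zero fun T hT => ?_, zero_add, biasedCharMean_empty, one_pow]
  simp only [mem_erase, degLE, mem_filter, mem_univ, true_and] at hT
  obtain ⟨i, hi⟩ := nonempty_iff_ne_empty.2 hT.1
  have : ∀ x : ι → Bool, biasedWalsh p T x = 0 := fun x =>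
    prod_eq_zero hi (hchar (x i))
  simp [biasedCharMean, this]

/-! ### `p = 1/2`: agreement with `lowDegreeLRSq` -/

/-- `φ_{1/2} = -sgn` (`true ↦ 1`, `false ↦ -1`). [folklore] -/
theorem biasChar_half (b : Bool) : biasChar (1 / 2) b = -sgn b := by
  have h : Real.sqrt (1 / 2 * (1 - 1 / 2)) = 1 / 2 := by
    rw [show (1 / 2 : ℝ) * (1 - 1 / 2) = (1 / 2) ^ 2 by norm_num, Real.sqrt_sq (by norm_num)]
  cases b
  · rw [biasChar_false, h, sgn_false]
    norm_num
  · rw [biasChar_true, h, sgn_true]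
    norm_num

omit [Fintype ι] [DecidableEq ι] in
/-- `χ^{1/2}_S = (-1)^{|S|} χ_S` (Walsh character of the tree). [folklore] -/
theorem biasedWalsh_half (S : Finset ι) (x : ι → Bool) :
    biasedWalsh (1 / 2) S x = (-1) ^ S.card * walsh S x := by
  simp only [biasedWalsh, walsh, biasChar_half]
  rw [← prod_const, ← prod_mul_distrib]
  refine prod_congr rfl fun i _ => ?_
  ring

/-- `E_μ[χ^{1/2}_S] = (-1)^{|S|} E_μ[χ_S]`. [folklore] -/
theorem biasedCharMean_half (μ : PMF (ι → Bool)) (S : Finset ι) :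
    biasedCharMean (1 / 2) μ S = (-1) ^ S.card * charMean μ S := by
  simp only [biasedCharMean, charMean, biasedWalsh_half, mul_sum]
  refine sum_congr rfl fun x _ => ?_
  ring

/-- **The requested agreement at `p = 1/2`**: the `1/2`-biased low-degree likelihood ratio is the
tree's `lowDegreeLRSq` (against the uniform null). [Hopkins 2018, proof of Lemma 2.4.1 (the basis
`∏ (2G_{ij} - 1)` at `p = 1/2`)] [folklore] -/
theorem biasedLowDegreeLRSq_half (μ : PMF (ι → Bool)) (D : ℕ) :
    biasedLowDegreeLRSq (1 / 2) μ D = lowDegreeLRSq μ D := by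
  unfold biasedLowDegreeLRSq lowDegreeLRSq
  refine sum_congr rfl fun S _ => ?_
  rw [biasedCharMean_half, mul_pow, ← pow_mul, mul_comm S.card 2, pow_mul, neg_one_sq, one_pow,
    one_mul]

/-- Hence also `biasedLowDegreeLR (1/2) = lowDegreeLR`. [folklore] -/
theorem biasedLowDegreeLR_half (μ : PMF (ι → Bool)) (D : ℕ) :
    biasedLowDegreeLR (1 / 2) μ D = lowDegreeLR μ D := by
  rw [biasedLowDegreeLR, lowDegreeLR, biasedLowDegreeLRSq_half]

/-! ### Character means see only marginals; the null has no nonconstant coefficients -/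

/-- Pushing a finite expectation forward along a map: `Σ_x μ(x) f(r x) = Σ_z (r_* μ)(z) f(z)`
(universe-polymorphic form of the helper in `Literature.Barriers.PneNP`). [folklore] -/
theorem sum_toReal_mul_eq_sum_map {α β : Type*} [Fintype α] [Fintype β] (μ : PMF α) (r : α → β)
    (f : β → ℝ) : ∑ x, (μ x).toReal * f (r x) = ∑ z, (μ.map r z).toReal * f z := by
  classical
  have hmap : ∀ z, (μ.map r z).toReal = ∑ x, if z = r x then (μ x).toReal else 0 := by
    intro z
    rw [PMF.map_apply, tsum_fintype, ENNReal.toReal_sum fun x _ => ?_]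
    · refine sum_congr rfl fun x _ => ?_
      split_ifs <;> simp
    · split_ifs <;> simp [PMF.apply_ne_top]
  simp_rw [hmap, sum_mul]
  rw [sum_comm]
  refine sum_congr rfl fun x _ => ?_
  simp_rw [ite_mul, zero_mul]
  rw [Finset.sum_ite_eq' univ (r x)]
  simp

/-- **A character mean depends only on the marginal on its support**:
`E_μ[χ^p_S] = Σ_{z : S → Bool} (μ|_S)(z) ∏_{i:S} φ_p(zᵢ)`. [folklore] -/
theorem biasedCharMean_eq_sum_map (p : ℝ) (μ : PMF (ι → Bool)) (S : Finset ι) :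
    biasedCharMean p μ S = ∑ z : S → Bool, (μ.map S.restrict z).toReal * ∏ i, biasChar p (z i) := by
  unfold biasedCharMean
  simp_rw [biasedWalsh_eq_comp_restrict]
  exact sum_toReal_mul_eq_sum_map μ S.restrict fun z => ∏ i, biasChar p (z i)

/-- Equal `S`-marginals give equal `S`-coefficients. [folklore] -/
theorem biasedCharMean_congr_of_map_restrict_eq {μ ν : PMF (ι → Bool)} {S : Finset ι}
    (h : μ.map S.restrict = ν.map S.restrict) (p : ℝ) :
    biasedCharMean p μ S = biasedCharMean p ν S := by
  rw [biasedCharMean_eq_sum_map, biasedCharMean_eq_sum_map, h]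

/-- **The null has no nonconstant Fourier coefficients**: `E_{ν_q}[χ^q_S] = 0` for `S ≠ ∅`
(the expectation factorises over coordinates and each factor on `S` is `E[φ_q] = 0`).
[O'Donnell 2014, §8.4; Hopkins 2018, §2.3] [folklore] -/
theorem biasedCharMean_bernoulliPi {q : ℝ≥0∞} (hq : q ≤ 1) {S : Finset ι} (hS : S.Nonempty) :
    biasedCharMean q.toReal (bernoulliPi ι q hq) S = 0 := by
  obtain ⟨i₀, hi₀⟩ := hS
  set g : ι → Bool → ℝ := fun i b =>
    (bernWeight q b).toReal * if i ∈ S then biasChar q.toReal b else 1 with hg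
  have hterm : ∀ x : ι → Bool,
      (bernoulliPi ι q hq x).toReal * biasedWalsh q.toReal S x = ∏ i, g i (x i) := by
    intro x
    rw [bernoulliPi_apply, ENNReal.toReal_prod, biasedWalsh, hg, prod_mul_distrib,
      prod_ite_mem_eq]
  unfold biasedCharMean
  simp_rw [hterm]
  rw [← Fintype.prod_sum g]
  refine prod_eq_zero (mem_univ i₀) ?_
  have : ∀ b, g i₀ b = (bernWeight q b).toReal * biasChar q.toReal b := fun b => by
    simp only [hg, if_pos hi₀]
  simp_rw [this]
  exact sum_bernWeight_mul_biasChar hq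

/-! ### `D`-wise independence forces `‖LR^{≤D}‖² = 1` -/

/-- **Exact independence kills the low-degree coefficients**: if `μ` is `D`-wise independent with
respect to `ν_q` then `E_μ[χ^q_S] = 0` for `0 < |S| ≤ D` ("we would recover the usual definition
of `D`-wise independence", Hopkins).
[cite: Hopkins2018, §2.2 remark after Def. 2.2.3 (PDF p. 44)] -/
theorem IsDWiseIndependentWrt.biasedCharMean_eq_zero {q : ℝ≥0∞} {hq : q ≤ 1} {D : ℕ}
    {μ : PMF (ι → Bool)} (h : IsDWiseIndependentWrt (bernoulliPi ι q hq) D μ) {S : Finset ι}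
    (hS : S.Nonempty) (hSD : S.card ≤ D) : biasedCharMean q.toReal μ S = 0 := by
  rw [biasedCharMean_congr_of_map_restrict_eq (h S hSD), biasedCharMean_bernoulliPi hq hS]

/-- **`D`-wise independence w.r.t. `ν_q` gives `‖LR^{≤D}‖²_{L²(ν_q)} = 1`** (its minimum,
`one_le_biasedLowDegreeLRSq`): only the constant character survives. Generalises
`Literature.Barriers.PneNP.IsDWiseIndependent.lowDegreeLRSq_eq_one` (`q = 1/2`, via
`biasedLowDegreeLRSq_half` and `isDWiseIndependentWrt_uniform_iff` of `BiasedLowDegreeBasis.lean`).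
[cite: Hopkins2018, §2.3 eq. (2.3.1) with the remark after Def. 2.2.3] -/
theorem IsDWiseIndependentWrt.biasedLowDegreeLRSq_eq_one {q : ℝ≥0∞} {hq : q ≤ 1} {D : ℕ}
    {μ : PMF (ι → Bool)} (h : IsDWiseIndependentWrt (bernoulliPi ι q hq) D μ) :
    biasedLowDegreeLRSq q.toReal μ D = 1 := by
  unfold biasedLowDegreeLRSq
  rw [← sum_erase_add _ _ (show (∅ : Finset ι) ∈ degLE ι D by simp [degLE])]
  rw [sum_eq_zero fun T hT => ?_, zero_add, biasedCharMean_empty, one_pow]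
  simp only [mem_erase, degLE, mem_filter, mem_univ, true_and] at hT
  rw [h.biasedCharMean_eq_zero (nonempty_iff_ne_empty.2 hT.1) hT.2, zero_pow two_ne_zero]

/-- In particular the null itself has `‖LR^{≤D}‖² = 1` for every `D` (`LR = 1`). [folklore] -/
theorem biasedLowDegreeLRSq_bernoulliPi {q : ℝ≥0∞} (hq : q ≤ 1) (D : ℕ) :
    biasedLowDegreeLRSq q.toReal (bernoulliPi ι q hq) D = 1 :=
  (IsDWiseIndependentWrt.refl (bernoulliPi ι q hq) D).biasedLowDegreeLRSq_eq_one

end Literature.Probability.RandomGraphs.LowDegree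

end
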